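import Summits.Ventures.YMGap.RobustBall.ZNGaugeLayer
import Summits.Ventures.YMGap.RobustBall.CentreProjection
import HarnessLib

/-!
# RobustBall/ZNGaugePeeling — Durhuus–Fröhlich peeling for the induced inhomogeneous `ℤ_N` gauge theory:
# given the transverse links the `i`-layers are independent, the Wilson loop factorises over the `R`
# rungs, and `‖⟨ψ(∮_{∂R×T} k)⟩‖ ≤ (4 c^T)^R` uniformly in the background

HONEST FRAMING: venture file of the cell `pub-ymgap` (track Y2 ROBUST-BALL, seat ds-4 g7): finite sums on a
finite torus — the UNIFORM AREA-LAW BOUND FOR THE INHOMOGENEOUS `ℤ_N` LATTICE GAUGE THEORY with plaquette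
weights `exp(β Re(ψ((curl k)_p) a_p))`, `‖a_p‖ ≤ A`, at `c = 2(d−1)|β|A ≤ 1`:
`‖⟨ψ(∮_{∂R×T} k)⟩‖ ≤ (4 c^T)^R` for every non-wrapping `R × T` rectangle (`2R, 2T ≤ L`), every `N ≥ 2`
(`norm_cavg_ψ_loopSum_le`; for the background of an `SU(N)` field, `a_p = tr U_p`, `A = N`:
`norm_znLoop_le`).  Mechanism (Durhuus–Fröhlich 1980 / Mack–Petkova 1979 §2, here for a pure plaquette
action, so no window is needed): condition on the transverse links (`ZN.sum_eq_sum_sum_glue`); the boundary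
sum splits into the transverse sides (a unimodular constant) and the `R` rungs `k(bot_r) − k(top_r)`
(`loopSum_glue`); distinct `i`-layers share no plaquette, so the layer weight factorises and the rung
average is the PRODUCT of the `R` single-rung averages (`cavg_ψ_rung_eq_prod`, block independence
`FiniteGibbs.cavg_mul_eq_of_dependsOn`), each of norm `≤ 4 c^T` (`ZN.norm_cavg_ψ_sub_le`, `jDist = T`).
No `SU(N)` measure and nothing about the continuum limit here.
-/

noncomputable section

open Finset Function
open Literature.MathematicalPhysics.QuantumFieldTheory

namespace Summit.Ventures.YMGap.RobustBall

namespace ZN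

variable {d L N : ℕ} [NeZero L] [NeZero N]

/-! ### Line sums as sums over the rungs -/

omit [NeZero L] [NeZero N] in
/-- `lineSum` as an explicit sum over the steps. [folklore] -/
theorem lineSum_eq_sum (k : Edge d L → ZMod N) (m : Fin d) :
    ∀ (n : ℕ) (y : Site d L), lineSum k m n y = ∑ r ∈ Finset.range n, k (y + Pi.single m ((r : ℕ) : ZMod L), m)
  | 0, y => by simp [lineSum]
  | n + 1, y => by
      rw [lineSum, lineSum_eq_sum k m n (y.shift m), Finset.sum_range_succ' _ (n := n)]
      simp only [Nat.cast_zero, Pi.single_zero, add_zero, Nat.cast_succ, Pi.single_add, Site.shift, add_assoc]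
      rw [add_comm]
      refine congrArg (· + _) (Finset.sum_congr rfl fun r _ => ?_)
      exact congrArg (fun s => k (y + s, m)) (add_comm _ _)

/-- The bottom site of rung `r`: `x + r e_i`. [folklore] -/
def bot (x : Site d L) (i : Fin d) (r : ℕ) : Site d L := x + Pi.single i ((r : ℕ) : ZMod L)

/-- The top site of rung `r`: `x + T e_j + r e_i`. [folklore] -/
def top (x : Site d L) (i j : Fin d) (T r : ℕ) : Site d L :=
  x + Pi.single j ((T : ℕ) : ZMod L) + Pi.single i ((r : ℕ) : ZMod L)

/-- The rung sum `∑_{r<n} (kI(bot r) − kI(top r))` of the `i`-link values. [folklore] -/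
def rung (x : Site d L) (i j : Fin d) (T n : ℕ) (kI : Site d L → ZMod N) : ZMod N :=
  ∑ r ∈ Finset.range n, (kI (bot x i r) - kI (top x i j T r))

/-- The transverse (`j`-directed) side sum of a glued configuration reads only `kT`. [folklore] -/
def transLine {i : Fin d} (j : Fin d) (hij : i ≠ j) (kT : Transverse d L (ZMod N) i) (n : ℕ) (y : Site d L) :
    ZMod N :=
  ∑ t ∈ Finset.range n, kT ⟨(y + Pi.single j ((t : ℕ) : ZMod L), j), hij.symm⟩

omit [NeZero L] [NeZero N] in
/-- `i`-directed line sums of a glued configuration read `kI`. [folklore] -/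
theorem lineSum_glue_self (i : Fin d) (kI : Site d L → ZMod N) (kT : Transverse d L (ZMod N) i) (n : ℕ)
    (y : Site d L) : lineSum (glue i kI kT) i n y = ∑ r ∈ Finset.range n, kI (y + Pi.single i ((r : ℕ) : ZMod L)) := by
  rw [lineSum_eq_sum]
  exact Finset.sum_congr rfl fun r _ => glue_apply_site i kI kT _

omit [NeZero L] [NeZero N] in
/-- `j`-directed line sums (`j ≠ i`) of a glued configuration read `kT` only. [folklore] -/
theorem lineSum_glue_of_ne {i j : Fin d} (hij : i ≠ j) (kI : Site d L → ZMod N)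
    (kT : Transverse d L (ZMod N) i) (n : ℕ) (y : Site d L) :
    lineSum (glue i kI kT) j n y = transLine j hij kT n y := by
  rw [lineSum_eq_sum, transLine]
  exact Finset.sum_congr rfl fun t _ => glue_apply_of_ne kI kT (e := (y + Pi.single j ((t : ℕ) : ZMod L), j)) hij.symm

omit [NeZero L] [NeZero N] in
/-- **The boundary sum of a glued configuration = rung sum + transverse sides.** [folklore] -/
theorem loopSum_glue {i j : Fin d} (hij : i ≠ j) (kI : Site d L → ZMod N) (kT : Transverse d L (ZMod N) i)
    (x : Site d L) (R T : ℕ) :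
    loopSum (glue i kI kT) x i j R T = rung x i j T R kI +
      (transLine j hij kT T (x + Pi.single i ((R : ℕ) : ZMod L)) - transLine j hij kT T x) := by
  rw [loopSum, lineSum_glue_self, lineSum_glue_self, lineSum_glue_of_ne hij, lineSum_glue_of_ne hij, rung,
    Finset.sum_sub_distrib]
  simp only [bot, top]
  ring

/-- `ψ` of a finite sum is the product of the `ψ`'s. [folklore] -/
theorem ψ_sum_range (f : ℕ → ZMod N) : ∀ n : ℕ, ψ N (∑ r ∈ Finset.range n, f r) = ∏ r ∈ Finset.range n, ψ N (f r)
  | 0 => by simp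
  | n + 1 => by rw [Finset.sum_range_succ, Finset.prod_range_succ, ψ_add, ψ_sum_range f n]

/-! ### Independence of the `i`-layers -/

omit [NeZero L] [NeZero N] in
/-- `i`-sites read by a plaquette lie in the `i`-layer of its base point. [folklore] -/
theorem apply_eq_of_mem_iSites (i : Fin d) (p : Plaquette d L) {y : Site d L} (hy : y ∈ iSites i p) : y i = p.1 i := by
  obtain ⟨z, ⟨⟨a, b⟩, hab⟩⟩ := p
  have hab' : a < b := hab
  simp only [iSites] at hy
  by_cases ha : a = i
  · have hb : b ≠ i := fun hbi => lt_irrefl i (by rw [ha, hbi] at hab'; exact hab')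
    simp only [ha, if_true, Finset.mem_insert, Finset.mem_singleton] at hy
    rcases hy with rfl | rfl
    · rfl
    · simp [Site.shift, Pi.single_eq_of_ne (Ne.symm hb)]
  · by_cases hb : b = i
    · simp only [ha, hb, if_false, if_true, Finset.mem_insert, Finset.mem_singleton] at hy
      rcases hy with rfl | rfl
      · simp [Site.shift, Pi.single_eq_of_ne (Ne.symm ha)]
      · rfl
    · simp [ha, hb] at hy

/-- An exponential of a sum of terms each reading only `B` reads only `B`. [folklore] -/
theorem dependsOn_exp_sum {V : Type*} {S : Type*} {P : Type*} (s : Finset P) (φ : P → (V → S) → ℝ) (β : ℝ)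
    (B : Set V) (h : ∀ p ∈ s, DependsOn (φ p) B) :
    DependsOn (fun σ : V → S => Real.exp (β * ∑ p ∈ s, φ p σ)) B := fun σ τ hστ => by
  simp only
  rw [Finset.sum_congr rfl fun p hp => h p hp hστ]

/-- **The rung average factorises over the rungs** (layers at distinct `i`-heights share no plaquette; block
independence `FiniteGibbs.cavg_mul_eq_of_dependsOn`): for `n ≤ R`, `2R ≤ L`,
`E ψ(rung_n) = ∏_{r<n} E ψ(kI(bot r) − kI(top r))`. [folklore] -/
theorem cavg_ψ_rung_eq_prod {i j : Fin d} (hij : i ≠ j) (kT : Transverse d L (ZMod N) i) (a : Plaquette d L → ℂ)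
    (β : ℝ) (x : Site d L) (R T : ℕ) (hR : 2 * R ≤ L) :
    ∀ n : ℕ, n ≤ R → FiniteGibbs.cavg (layerWeight i kT a β) (fun kI => ψ N (rung x i j T n kI)) =
      ∏ r ∈ Finset.range n, FiniteGibbs.cavg (layerWeight i kT a β) (fun kI => ψ N (kI (bot x i r) - kI (top x i j T r)))
  | 0, _ => by
      simp only [rung, Finset.sum_range_zero, Finset.prod_range_zero, ψ_zero]
      rw [FiniteGibbs.cavg]
      have hm : (FiniteGibbs.mass (layerWeight i kT a β) : ℂ) ≠ 0 := by
        rw [Ne, Complex.ofReal_eq_zero]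
        exact (FiniteGibbs.mass_pos_of_pos (layerWeight_pos i kT a β)).ne'
      simp only [mul_one]
      rw [show (∑ σ : Site d L → ZMod N, (layerWeight i kT a β σ : ℂ)) = (FiniteGibbs.mass (layerWeight i kT a β) : ℂ)
        by rw [FiniteGibbs.mass]; push_cast; rfl, div_self hm]
  | n + 1, hn => by
      classical
      have ih := cavg_ψ_rung_eq_prod hij kT a β x R T hR n (Nat.le_of_succ_le hn)
      rw [Finset.prod_range_succ, ← ih]
      -- the layer of rung `n`
      set B : Finset (Site d L) := Finset.univ.filter fun y => y i = x i + ((n : ℕ) : ZMod L) with hB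
      set u : (Site d L → ZMod N) → ℝ := fun kI =>
        Real.exp (β * ∑ p ∈ Finset.univ.filter (fun p : Plaquette d L => p.1 i = x i + ((n : ℕ) : ZMod L)),
          phiP i kT a p kI) with hu
      set v : (Site d L → ZMod N) → ℝ := fun kI =>
        Real.exp (β * ∑ p ∈ Finset.univ.filter (fun p : Plaquette d L => ¬p.1 i = x i + ((n : ℕ) : ZMod L)),
          phiP i kT a p kI) with hv
      have hw : layerWeight i kT a β = fun kI => u kI * v kI := by
        funext kI
        rw [hu, hv]; dsimp only
        rw [← Real.exp_add, ← mul_add, layerWeight,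
          ← Finset.sum_filter_add_sum_filter_not Finset.univ (fun p : Plaquette d L => p.1 i = x i + ((n : ℕ) : ZMod L))]
      have hBmem : ∀ y : Site d L, y ∈ (↑B : Set (Site d L)) ↔ y i = x i + ((n : ℕ) : ZMod L) := fun y => by
        rw [Finset.mem_coe, hB, Finset.mem_filter]; simp
      have hdepU : DependsOn u (↑B : Set (Site d L)) := by
        refine dependsOn_exp_sum _ _ β _ fun p hp => (dependsOn_phiP i kT a p).mono fun y hy => ?_
        rw [hBmem, apply_eq_of_mem_iSites i p (Finset.mem_coe.1 hy)]
        exact (Finset.mem_filter.1 hp).2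
      have hdepV : DependsOn v (↑B : Set (Site d L))ᶜ := by
        refine dependsOn_exp_sum _ _ β _ fun p hp => (dependsOn_phiP i kT a p).mono fun y hy => ?_
        rw [Set.mem_compl_iff, hBmem, apply_eq_of_mem_iSites i p (Finset.mem_coe.1 hy)]
        exact (Finset.mem_filter.1 hp).2
      -- the new rung reads layer `n`, the old rungs read the other layers
      have hbot : ∀ r : ℕ, bot x i r i = x i + ((r : ℕ) : ZMod L) := fun r => by simp [bot]
      have htop : ∀ r : ℕ, top x i j T r i = x i + ((r : ℕ) : ZMod L) := fun r => by
        simp [top, Pi.single_eq_of_ne hij]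
      have hF : DependsOn (fun kI : Site d L → ZMod N => ψ N (kI (bot x i n) - kI (top x i j T n))) (↑B : Set (Site d L)) :=
        fun kI kI' h => by
          simp only
          rw [h _ ((hBmem _).2 (hbot n)), h _ ((hBmem _).2 (htop n))]
      have hne : ∀ r ∈ Finset.range n, x i + ((r : ℕ) : ZMod L) ≠ x i + ((n : ℕ) : ZMod L) := by
        intro r hr h
        have hrn : r < n := Finset.mem_range.1 hr
        have h' : ((r : ℕ) : ZMod L) = ((n : ℕ) : ZMod L) := add_left_cancel h
        rw [ZMod.natCast_eq_natCast_iff'] at h'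
        rw [Nat.mod_eq_of_lt (by omega), Nat.mod_eq_of_lt (by omega)] at h'
        omega
      have hG : DependsOn (fun kI : Site d L → ZMod N => ψ N (rung x i j T n kI)) (↑B : Set (Site d L))ᶜ :=
        fun kI kI' h => by
          simp only [rung]
          rw [Finset.sum_congr rfl fun r hr => by
            rw [h _ (by rw [Set.mem_compl_iff, hBmem, hbot]; exact hne r hr),
              h _ (by rw [Set.mem_compl_iff, hBmem, htop]; exact hne r hr)]]
      have hm : FiniteGibbs.mass (fun kI => u kI * v kI) ≠ 0 := by
        rw [← hw]; exact (FiniteGibbs.mass_pos_of_pos (layerWeight_pos i kT a β)).ne'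
      have key := FiniteGibbs.cavg_mul_eq_of_dependsOn B hdepU hdepV hF hG hm
      rw [← hw] at key
      rw [mul_comm, ← key]
      refine congrArg _ (funext fun kI => ?_)
      rw [rung, Finset.sum_range_succ, ψ_add, mul_comm, ← rung]

/-! ### The uniform `ℤ_N` area-law bound -/

/-- **Uniform area-law bound for the inhomogeneous `ℤ_N` gauge theory, layer form**: given the transverse
links, `‖E ψ(rung_R)‖ ≤ (4 c^T)^R` (`N ≥ 2`, `c = 2(d−1)|β|A ≤ 1`, `2R, 2T ≤ L`). [folklore] -/
theorem norm_cavg_ψ_rung_le (hN : 2 ≤ N) {i j : Fin d} (hij : i ≠ j) (kT : Transverse d L (ZMod N) i)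
    {a : Plaquette d L → ℂ} {A : ℝ} (hA0 : 0 ≤ A) (hA : ∀ p, ‖a p‖ ≤ A) (β : ℝ) {c : ℝ}
    (hc : 2 * ((d - 1 : ℕ) : ℝ) * |β| * A ≤ c) (hc1 : c ≤ 1) (x : Site d L) {R T : ℕ} (hR : 2 * R ≤ L)
    (hT : 2 * T ≤ L) :
    ‖FiniteGibbs.cavg (layerWeight i kT a β) (fun kI => ψ N (rung x i j T R kI))‖ ≤ (4 * c ^ T) ^ R := by
  rw [cavg_ψ_rung_eq_prod hij kT a β x R T hR R le_rfl, norm_prod, ← Finset.card_range R, ← Finset.prod_const,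
    Finset.card_range]
  refine Finset.prod_le_prod (fun r _ => norm_nonneg _) fun r _ => ?_
  have h := norm_cavg_ψ_sub_le hN i j kT hA0 hA β hc hc1 (bot x i r) (top x i j T r)
  rwa [show jDist j (top x i j T r) (bot x i r) = T from jDist_rung hij x r T hT] at h

/-- The `ℤ_N` weight with general complex plaquette couplings `a`. [folklore] -/
def znW (β : ℝ) (a : Plaquette d L → ℂ) (k : Edge d L → ZMod N) : ℝ :=
  Real.exp (β * ∑ p : Plaquette d L, (ψ N (plaqSum k p.1 p.2.1.1 p.2.1.2) * a p).re)

/-- On a glued configuration the `ℤ_N` weight is the layer weight. [folklore] -/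
theorem znW_glue (β : ℝ) (a : Plaquette d L → ℂ) (i : Fin d) (kI : Site d L → ZMod N)
    (kT : Transverse d L (ZMod N) i) : znW β a (glue i kI kT) = layerWeight i kT a β kI := rfl

/-- **UNIFORM AREA-LAW BOUND FOR THE INHOMOGENEOUS `ℤ_N` LATTICE GAUGE THEORY**: for `N ≥ 2`, couplings
`‖a_p‖ ≤ A`, `c = 2(d−1)|β|A ≤ 1` and a non-wrapping `R × T` rectangle in the `(i, j)` plane,
`‖⟨ψ(∮_{∂R×T} k)⟩‖ ≤ (4 c^T)^R`. [cite: MackPetkova1979, §2] -/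
theorem norm_cavg_ψ_loopSum_le (hN : 2 ≤ N) {i j : Fin d} (hij : i ≠ j) {a : Plaquette d L → ℂ} {A : ℝ}
    (hA0 : 0 ≤ A) (hA : ∀ p, ‖a p‖ ≤ A) (β : ℝ) {c : ℝ} (hc : 2 * ((d - 1 : ℕ) : ℝ) * |β| * A ≤ c) (hc1 : c ≤ 1)
    (x : Site d L) {R T : ℕ} (hR : 2 * R ≤ L) (hT : 2 * T ≤ L) :
    ‖FiniteGibbs.cavg (znW β a) (fun k => ψ N (loopSum k x i j R T))‖ ≤ (4 * c ^ T) ^ R := by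
  set M := (4 * c ^ T) ^ R with hM
  have hmass : 0 < FiniteGibbs.mass (znW (N := N) (L := L) β a) := FiniteGibbs.mass_pos_of_pos fun k => Real.exp_pos _
  rw [FiniteGibbs.cavg, norm_div, Complex.norm_real, Real.norm_eq_abs, abs_of_pos hmass, div_le_iff₀ hmass]
  -- split numerator and mass into transverse and layer sums
  rw [sum_eq_sum_sum_glue i, FiniteGibbs.mass, sum_eq_sum_sum_glue i, Finset.mul_sum]
  refine (norm_sum_le _ _).trans (Finset.sum_le_sum fun kT _ => ?_)
  -- on the fibre of `kT` the transverse sides are a unimodular constant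
  have hfac : ∑ kI : Site d L → ZMod N, (znW β a (glue i kI kT) : ℂ) * ψ N (loopSum (glue i kI kT) x i j R T) =
      ψ N (transLine j hij kT T (x + Pi.single i ((R : ℕ) : ZMod L)) - transLine j hij kT T x) *
        ∑ kI : Site d L → ZMod N, (layerWeight i kT a β kI : ℂ) * ψ N (rung x i j T R kI) := by
    rw [Finset.mul_sum]
    refine Finset.sum_congr rfl fun kI _ => ?_
    rw [znW_glue, loopSum_glue hij, ψ_add]; ring
  have hlayer : ∑ kI : Site d L → ZMod N, (layerWeight i kT a β kI : ℂ) * ψ N (rung x i j T R kI) =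
      (FiniteGibbs.mass (layerWeight i kT a β) : ℂ) *
        FiniteGibbs.cavg (layerWeight i kT a β) (fun kI => ψ N (rung x i j T R kI)) := by
    rw [FiniteGibbs.cavg, mul_div_cancel₀]
    rw [Ne, Complex.ofReal_eq_zero]
    exact (FiniteGibbs.mass_pos_of_pos (layerWeight_pos i kT a β)).ne'
  rw [hfac, hlayer, norm_mul, norm_ψ, one_mul, norm_mul, Complex.norm_real, Real.norm_eq_abs,
    abs_of_pos (FiniteGibbs.mass_pos_of_pos (layerWeight_pos i kT a β)), FiniteGibbs.mass]
  simp only [znW_glue]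
  rw [mul_comm]
  exact mul_le_mul_of_nonneg_right (norm_cavg_ψ_rung_le hN hij kT hA0 hA β hc hc1 x hR hT)
    (Finset.sum_nonneg fun kI _ => (layerWeight_pos i kT a β kI).le)

end ZN

/-! ### The `ℤ_N` Wilson loop induced by an `SU(N)` background -/

variable {d L N : ℕ} [NeZero L] [NeZero N]

/-- The induced weight of an `SU(N)` background is the `ℤ_N` weight with couplings `a_p = tr U_p`. [folklore] -/
theorem znWeight_eq_znW (β : ℝ) (U : GaugeConfig d L (SUN N)) :
    znWeight β U = ZN.znW β fun p : Plaquette d L =>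
      ((plaquetteHolonomy U p.1 p.2.1.1 p.2.1.2 : SUN N) : Matrix (Fin N) (Fin N) ℂ).trace := by
  funext k; rfl

/-- **The `ℤ_N` Wilson loop induced by ANY `SU(N)` background obeys the uniform area-law bound**
`‖znLoop β U‖ ≤ (4 c^T)^R`, `c = 2(d−1)N|β| ≤ 1`, `N ≥ 2`, `i ≠ j`, `2R, 2T ≤ L`. [folklore] -/
theorem norm_znLoop_le (hN : 2 ≤ N) (β : ℝ) {c : ℝ} (hc : 2 * ((d - 1 : ℕ) : ℝ) * |β| * N ≤ c) (hc1 : c ≤ 1)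
    (U : GaugeConfig d L (SUN N)) (x : Site d L) {i j : Fin d} (hij : i ≠ j) {R T : ℕ} (hR : 2 * R ≤ L)
    (hT : 2 * T ≤ L) : ‖znLoop β U x i j R T‖ ≤ (4 * c ^ T) ^ R := by
  rw [znLoop, znWeight_eq_znW]
  exact ZN.norm_cavg_ψ_loopSum_le hN hij (Nat.cast_nonneg N) (fun p => norm_trace_le _) β hc hc1 x hR hT

end Summit.Ventures.YMGap.RobustBall

end
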